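import Summits.ABC.IUTFork.Joshi.ArithTeichmullerSpace
import Literature.AnabelianGeometry.AbsoluteAnabelian.GaloisPadicLogIntegers
import HarnessLib

/-!
# Joshi, *Arithmetic Teichmüller spaces I* §9 — the functors from `𝔍(X,E)` to "Mochizuki's anabelian landscape"
# (`Π ↷ 𝒪^▹_{Ē}`, `𝒪^*_{Ē}`, `𝒪^{×μ}_{Ē}`), "prime-strips à la Joshi" as LABELED copies, and the global space `∏_℘ 𝔍(X,L_℘)`

Record file of the abc-iut cell, branch E (seat abc-iut-E-t1; rung LADDER-ABC:A2.E; plan/E OBJECTS heading E3,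
ASSIGNMENTS row E-t1 "J1 §§9–11"); sequel to `ArithTeichmullerSpace` (p428170). TAKES NO SIDE on [IUTchIII]
Cor. 3.12 or on any author; typed ≠ proved ≠ endorsed. Source: K. Joshi, arXiv 2106.11452 (unrefereed), §9
"Relationship to Mochizuki's Anabelian Landscape" (render chunks p0024–p0025) and §8 Thm (th:main4) (chunk p0023).
[claim: Joshi2021ATS1, status: disputed]

WHAT IS TYPED.
* §1 The monoids of the landscape on the FIXED algebraic closure `Q̄_p = PadicAlgCl p` (Mathlib, `p`-adic = spectral
  norm) are the TREE's ([AbsTopIII] Def. 3.1 (i), `Literature.AnabelianGeometry.AbsoluteAnabelian`, files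
  `MLFGaloisModel` / `GaloisPadicLogIntegers`): `integersClosure ℚ_[p] (PadicAlgCl p)` = `𝒪_{Q̄_p}` (`= {‖x‖ ≤ 1}`,
  `PadicAlgCl.mem_integersClosure_iff`), `nonzeroIntegers` = `𝒪^▹ = 𝒪 − {0}`, `unitSubmonoid` = `𝒪^*` (`= {‖x‖ = 1}`,
  `PadicAlgCl.mem_unitSubmonoid_iff`), with `smul_mem_nonzeroIntegers` / `smul_mem_unitSubmonoid` (Galois preserves
  them); `𝒪^{×μ} = 𝒪^*/μ` is the tree's `Literature.IUT.HodgeArakelov.KummerStructures.UnitsModTorsion` — nothing is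
  re-declared here (§9 chunk p0024: "Both these notations were introduced and used extensively in [IUT]"). The only
  local lemma is the one-line `norm_galois` (Galois automorphisms are isometries, Mathlib `spectralNorm_eq_of_equiv`).
* §2 The action `Π^temp(Y/E′) ↷ 𝒪^▹_{Ē′}` "via the surjection `Π^temp(Y/E′) → G_{E′}` and the tautological action of
  `G_{Ē′}`" (chunk p0025), through the tree's augmentation `TemperedCurve.aug : Π^temp → G_{ℚ_p}`: `piSmul`,
  `piSmul_mem_nonzeroIntegers`. Joshi's FUNCTORS (pa:anab-functors) (chunk p0025; Thm (th:main4.5) (4), chunk p0022)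
  "`(Y/E′, E′ ↪ K) ↦ Π^temp(Y/E′;K) ↷[K] 𝒪^*_{Ē′}`, … `↷[K] 𝒪^{×μ}`, … `↷[K] 𝒪^▹_{Ē′}`, where `[K]` means that the field `K` is
  used to compute the algebraic closure of `E′`" are typed as `ATSObj.landscape A : LandscapeDatum p` = (the group
  `Π^temp(Y/E′)`, its action on `Q̄_p` through `G_{ℚ_p}`, and the LABEL `K`): in the tree the algebraic closure is the
  fixed `AlgebraicClosure ℚ_[p]`, and "computed inside `K`" is exactly the label (cf. `UntiltPoints.algCl` in
  `ArithTeichmullerAction`: the identification with the copy inside `K_y` is a datum there).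
* §3 "PRIME-STRIPS À LA JOSHI" (chunk p0025: "`𝓕 = Π^temp(Y/E) ↷[K] 𝒪^▹_{Ē}` … `𝓕^{⊢×}_K := G_E ↷[K] 𝒪^×_{Ē}` … there exist
  many distinctly labeled prime-strips"): `landscape_injective_label` (distinct labels, distinct data — the
  "many"), `landscape_relabel` (the `Aut(Π)`-relabelling does not touch the strip). OUR prime-strips are
  `Literature.IUT.HodgeTheaters.BasePrimeStrips` (`DPrimeStrip`), `…FrobenioidBridgeModels` (`FPrimeStrip`),
  `Literature.IUT.HodgeArakelov.KummerPrimeStripCategories` (`FTimesMuPrimeStrip`) — cited BY NAME only; the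
  table-level dictionary (Rosetta Stone Fragment 3, [Joshi2024ATS3] §8.5–8.6) is seat E-t17's `RosettaFragments34`.
* §4 Thm (th:main4) (chunk p0023): "the Arithmetic Teichmuller Space associated to `X/L` … `𝔍(X,L) = ∏_℘ 𝔍(X,L_℘)`" —
  `GlobalATSObj`: a family of local objects over the FINITE places (one residue characteristic `p ℘` each); the
  archimedean factors ("by design the classical Teichmuller space", chunk p0004) are not in the tree and are omitted
  (INTERFACE BOUNDARY). [Joshi2024ATS3] Lemma 2.1.6 ("each holomorphoid provides a unique object of
  `𝔍(X/L) = ∏_{v} 𝔍(X/L_v)`") targets this type (seat E-t5).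
Deliberately NOT here: (pa:diff-from-iut) / Remark 2 (E6 attach points — locator rows only, plan/E); the Artin–Hasse
identification `𝒢(𝒪_{ℂ_p^♭}) ≅ Ĝ_m(𝒪_{ℂ_p^♭})` (Lemma (le:artin-hasse-exp), a statement about objects not typed); §10
(theta-values locus: heading E2, seat E-t3); §11 (self-similarity: P4, not on a path to S per plan/E/ASSIGNMENTS §1).
-/

noncomputable section

namespace Summit.ABC.IUTFork.Joshi

open Literature.AnabelianGeometry.SemiGraphs (TemperedCurve GQp)
open Literature.AnabelianGeometry.AbsoluteAnabelian (nonzeroIntegers unitSubmonoid smul_mem_nonzeroIntegers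
  smul_mem_unitSubmonoid)

variable {p : ℕ} [Fact p.Prime]

/-! ## 1. Galois isometry on the fixed `Q̄_p` (the monoids `𝒪`, `𝒪^▹`, `𝒪^*` are the tree's) -/

/-- **Galois automorphisms of `Q̄_p/ℚ_p` are isometries** for the `p`-adic norm of `PadicAlgCl p` — a one-line
consequence of Mathlib's `spectralNorm_eq_of_equiv` (the spectral norm only depends on the minimal polynomial);
kept because no tree lemma has this exact shape (`MLFGaloisModelRigidity.norm_galois` is about `Hom`). [folklore] -/
theorem norm_galois (σ : GQp p) (x : PadicAlgCl p) : ‖σ x‖ = ‖x‖ :=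
  (spectralNorm_eq_of_equiv σ x).symm

/-- Galois preserves `𝒪^▹_{Q̄_p}` = the tree's `nonzeroIntegers ℚ_[p] (PadicAlgCl p)` ([AbsTopIII] Def. 3.1 (i) typing,
`smul_mem_nonzeroIntegers`). [folklore] -/
theorem galois_mem_nonzeroIntegers (σ : GQp p) {x : PadicAlgCl p} (hx : x ∈ nonzeroIntegers ℚ_[p] (PadicAlgCl p)) :
    σ x ∈ nonzeroIntegers ℚ_[p] (PadicAlgCl p) :=
  smul_mem_nonzeroIntegers σ hx

/-- Galois preserves `𝒪^*_{Q̄_p}` = the tree's `unitSubmonoid ℚ_[p] (PadicAlgCl p)` (`smul_mem_unitSubmonoid`). [folklore] -/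
theorem galois_mem_unitSubmonoid (σ : GQp p) {x : PadicAlgCl p} (hx : x ∈ unitSubmonoid ℚ_[p] (PadicAlgCl p)) :
    σ x ∈ unitSubmonoid ℚ_[p] (PadicAlgCl p) :=
  smul_mem_unitSubmonoid σ hx

/-! ## 2. `Π^temp(Y/E′) ↷ 𝒪^▹` through the augmentation, and Joshi's landscape functors -/

/-- The action of `Π^temp(Y/E′)` on `Q̄_p` "via the surjection `Π^temp(Y/E′) → G_{E′}` and the tautological action" (§9
chunk p0025), through the tree's augmentation `Y.aug : Π^temp(Y/E′) → G_{ℚ_p}` (image `G_{E′}`). [claim: Joshi2021ATS1, status: disputed] -/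
def piSmul (Y : TemperedCurve p) (g : Y.PiTemp) (x : PadicAlgCl p) : PadicAlgCl p := Y.aug g x

/-- The action is by isometries. [folklore] -/
theorem norm_piSmul (Y : TemperedCurve p) (g : Y.PiTemp) (x : PadicAlgCl p) : ‖piSmul Y g x‖ = ‖x‖ :=
  norm_galois _ x

/-- `Π^temp(Y/E′) ↷ 𝒪^▹`: the action preserves the tree's monoid of nonzero integers `nonzeroIntegers ℚ_[p] (PadicAlgCl p)`.
[folklore] -/
theorem piSmul_mem_nonzeroIntegers (Y : TemperedCurve p) (g : Y.PiTemp) {x : PadicAlgCl p}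
    (hx : x ∈ nonzeroIntegers ℚ_[p] (PadicAlgCl p)) : piSmul Y g x ∈ nonzeroIntegers ℚ_[p] (PadicAlgCl p) :=
  galois_mem_nonzeroIntegers _ hx

/-- `Π^temp(Y/E′) ↷ 𝒪^*` (the tree's `unitSubmonoid ℚ_[p] (PadicAlgCl p)`). [folklore] -/
theorem piSmul_mem_unitSubmonoid (Y : TemperedCurve p) (g : Y.PiTemp) {x : PadicAlgCl p}
    (hx : x ∈ unitSubmonoid ℚ_[p] (PadicAlgCl p)) : piSmul Y g x ∈ unitSubmonoid ℚ_[p] (PadicAlgCl p) :=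
  galois_mem_unitSubmonoid _ hx

/-- `piSmul` is an action: the identity acts trivially … [folklore] -/
theorem piSmul_one (Y : TemperedCurve p) (x : PadicAlgCl p) : piSmul Y 1 x = x := by
  simp [piSmul]

/-- … and products act as composites. [folklore] -/
theorem piSmul_mul (Y : TemperedCurve p) (g h : Y.PiTemp) (x : PadicAlgCl p) :
    piSmul Y (g * h) x = piSmul Y g (piSmul Y h x) := by
  simp [piSmul, map_mul, AlgEquiv.mul_apply]

/-- **A datum of "Mochizuki's anabelian landscape" à la Joshi**: a topological group `Π` ACTING (action laws
recorded) on `Q̄_p` preserving the monoid `𝒪^▹_{Q̄_p}` (the tree's `nonzeroIntegers ℚ_[p] (PadicAlgCl p)`; hence acting on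
`𝒪^*`, `𝒪^{×μ}`), TOGETHER WITH A LABEL — the algebraically closed perfectoid field "used to compute the algebraic
closure" (§9 chunk p0025: "`Π^temp(Y/E′;K) ↷[K] 𝒪^*_{Ē′}` means that the field `K` is used to compute the algebraic
closure of `E′`"; "there exist many distinctly labeled primes strips `𝓕^{⊢×}_K`"). In the tree the algebraic closure is
the fixed `PadicAlgCl p`; the label is what distinguishes the copies. Nearest tree object: [AbsTopIII] Def. 3.1 (i)
model data `Literature.AnabelianGeometry.AbsoluteAnabelian.ModelMLFGaloisData` (`Π_k ↠ G_k`; there the augmentation is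
ONTO `Gal(k̄/k)`, here the action comes through `G_{ℚ_p}` with image `G_{E′}`, and a label is added). Continuity of
the action is not recorded (the augmentation `TemperedCurve.aug` is continuous; the Krull action on the discrete
`Q̄_p` is not the point here). [claim: Joshi2021ATS1, status: disputed] -/
structure LandscapeDatum (p : ℕ) [Fact p.Prime] : Type 1 where
  /-- the group `Π` -/
  Γ : Type
  [group : Group Γ]
  [topologicalSpace : TopologicalSpace Γ]
  /-- its action on `Q̄_p` -/
  smul : Γ → PadicAlgCl p → PadicAlgCl p
  /-- action law: the identity acts trivially -/
  smul_one : ∀ x, smul 1 x = x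
  /-- action law: products act as composites -/
  smul_mul : ∀ g h x, smul (g * h) x = smul g (smul h x)
  /-- … preserving `𝒪^▹` -/
  smul_mem : ∀ (g : Γ) {x : PadicAlgCl p}, x ∈ nonzeroIntegers ℚ_[p] (PadicAlgCl p) →
    smul g x ∈ nonzeroIntegers ℚ_[p] (PadicAlgCl p)
  /-- the label `K` -/
  label : Untilt p

attribute [instance] LandscapeDatum.group LandscapeDatum.topologicalSpace

namespace ATSObj

variable {X : TemperedCurve p}

/-- **Joshi's functor to the anabelian landscape, on objects** ((pa:anab-functors), chunk p0025; Thm (th:main4.5)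
(4), chunk p0022): "`(Y/E′, E′ ↪ K) ↦ Π^temp(Y/E′;K) ↷[K] 𝒪^▹_{Ē′}`" (and the `𝒪^*`, `𝒪^{×μ}`, `Ē′^*` variants, which are
sub- or quotient data of this one) — "the prime strip (in Mochizuki's notation) `𝓕 = Π^temp(Y/E) ↷[K] 𝒪^▹_{Ē}`" à la
Joshi. [claim: Joshi2021ATS1, status: disputed] -/
def landscape (A : ATSObj X) : LandscapeDatum p where
  Γ := A.Y.PiTemp
  smul := piSmul A.Y
  smul_one := piSmul_one A.Y
  smul_mul := piSmul_mul A.Y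
  smul_mem g _ hx := piSmul_mem_nonzeroIntegers A.Y g hx
  label := A.U

/-- The label of the landscape datum is the perfectoid field of the object (the forgetful functor
`(Y/E′, E′ ↪ K) ↦ K`). [folklore] -/
theorem landscape_label (A : ATSObj X) : A.landscape.label = A.U := rfl

/-! ## 3. "Many distinctly labeled prime-strips" -/

/-- **"there exist many distinctly labeled prime strips `𝓕^{⊢×}_K := G_E ↷[K] 𝒪^×_{Ē}`"** (§9 chunk p0025), typed: objects
with different perfectoid fields have different landscape data (the label is part of the datum) — in particular
the `ℂ_p`-object of `ATSObj.nonempty` and any object with another `K`. A triviality of the typing recording WHERE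
the plurality sits: in the label, not in the group action (which is the same `G_{E′}`-action on the one `𝒪^▹_{Q̄_p}`
for all labels). [claim: Joshi2021ATS1, status: disputed] -/
theorem landscape_injective_label {A B : ATSObj X} (h : A.landscape = B.landscape) : A.U = B.U := by
  rw [← landscape_label A, ← landscape_label B, h]

/-- The underlying (unlabeled) action depends only on the curve `Y/E′`: two objects over the same `Y` give the
SAME group acting in the SAME way — Joshi §9 Remark 2 (chunk p0029) read on the typing: "the variation … arises
because of the variation of `(X/E, E ↪ K) ∈ 𝔍(X,E)`", i.e. through the label. [folklore] -/
theorem landscape_smul_eq_of_Y_eq {A B : ATSObj X} (h : A.Y = B.Y) :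
    HEq A.landscape.smul B.landscape.smul := by
  cases A; cases B; cases h; rfl

/-! ## 4. The global arithmetic Teichmüller space `∏_℘ 𝔍(X,L_℘)` (finite places) -/

/-- **Thm (th:main4)** (chunk p0023): "the Arithmetic Teichmuller Space associated to `X/L` … is given as a product
category `𝔍(X,L) = ∏_℘ 𝔍(X,L_℘)` where `℘` runs over all the inequivalent, non-trivial valuations of `L`". Typed over
an index type `ι` of FINITE places with residue characteristics `pOf ℘` and the local curves `X ℘ = X ×_L L_℘` with
their tempered fundamental groups: an object is a family of local objects. INTERFACE BOUNDARY: the archimedean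
factors ("the classical Teichmuller space", §8 chunk p0019) and the number field `L` itself are not typed; this is
the target type of [Joshi2024ATS3] Lemma 2.1.6 (holomorphoid ↦ object of `∏_v 𝔍(X/L_v)`, seat E-t5).
[claim: Joshi2021ATS1, status: disputed] -/
def _root_.Summit.ABC.IUTFork.Joshi.GlobalATSObj (ι : Type) (pOf : ι → ℕ) [∀ ℘, Fact (pOf ℘).Prime]
    (X : ∀ ℘ : ι, TemperedCurve (pOf ℘)) : Type 1 :=
  ∀ ℘ : ι, ATSObj (X ℘)

/-- The global space is non-empty (componentwise `(X_℘, ℂ_{p_℘}, id)`; Thm (th:main4) (2) "an anabelian variation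
providing the adelic tempered fundamental group" then holds componentwise by `ATSObj.variation`). [folklore] -/
theorem _root_.Summit.ABC.IUTFork.Joshi.GlobalATSObj.nonempty (ι : Type) (pOf : ι → ℕ) [∀ ℘, Fact (pOf ℘).Prime]
    (X : ∀ ℘ : ι, TemperedCurve (pOf ℘)) : Nonempty (GlobalATSObj ι pOf X) :=
  ⟨fun ℘ => (ATSObj.nonempty (X ℘)).some⟩

end ATSObj

end Summit.ABC.IUTFork.Joshi

end
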